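import Literature.Computability.AlgebraicComplexity.UnitTensorSLObstructions
import Literature.Computability.AlgebraicComplexity.MatMulOccurrenceObstructionsProofs
import HarnessLib

/-!
# The unit-tensor half of Bürgisser–Ikenmeyer's `G`-obstruction `λₙ` (STOC 2011, Lemma 6.1), proved

Topic `Literature/Computability/AlgebraicComplexity` (geometric complexity theory, tensor setting);
proofs file (theorems only: no definitions, no named facts) for the typed-chain file
`UnitTensorSLObstructions.lean` of the cell `pub-gct-max` (track T, seat lit-2), whose NAMED fact
`burgisserIkenmeyer2011_lemma_6_1` records P. Bürgisser, C. Ikenmeyer, *Geometric complexity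
theory and tensor rank*, STOC 2011 = arXiv:1011.1350 [BurgisserIkenmeyer2011], Lemma 6.1:
"We have `λₙ := (2^{n²} 0, 2^{n²} 0, (2n²−3) 1 1 1 0^{n²−3}) ∈ S(⟨n,n,n⟩) ∖ S°(⟨n²+1⟩)` for
`n ≥ 2`. This implies `R̲(⟨n,n,n⟩) > n² + 1`." The tree records (i) occurrence of the type
`λₙ = ((2n²−3,1,1,1), 2^{n²}, 2^{n²})` in degree `2n²` for `⟨n,n,n⟩` and (ii) NON-occurrence in
degree `2n²` for the unit tensor `⟨n²+1⟩` — the printed CLOSURE consequence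
`λₙ ∉ S(⟨n²+1⟩) ⊆ S°(⟨n²+1⟩)` (§3.4) of the printed orbit statement (occurrence = non-vanishing
of the triple isotypic character sum, as in `IsotypicPressure.lean` / `UnitTensorMomentPolytope.lean`).
Honest framing of the cell: a kernel-checked half of ONE printed `G`-obstruction in the TENSOR
setting, whose numerical consequence `R̲(⟨n,n,n⟩) > n²+1` is far from new (Rem. 6.2(2)) and is
already discharged in the tree from Strassen–Lickteig
(`burgisserIkenmeyer2011_lemma_6_1_bound_holds`); multiplicity data and certified rank bounds at
small parameters; occurrence obstructions are ruled out in print for determinant versus padded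
permanent (BIP 2019) — nothing here is a claim on VP vs VNP or P vs NP.

## What is printed

* Lemma 6.1 (above) and its proof sketch: "1. We apply Theorem 4.4. Put `N := n²` and
  `λₙ = (λ₁,λ₂,λ₃)`. The only partitions `α ∈ Par_{N+1}(2N)` smaller than `λ₁, λ₂, λ₃` are
  `2^N 0` and `2^{N−1} 1²`. A computation using the tableaux straightening algorithm from
  [11, p.110] shows that `(V^α_{λ₁} ⊗ V^α_{λ₂} ⊗ V^α_{λ₃})^{stab(α)} = 0` for both `α`.
  Proposition 3.4 tells us that `λₙ ∉ S°(⟨n²+1⟩)`. 2. Using [31, 33] one can show `g(λₙ) = 1`.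
  Hence the highest weight vector `f ∈ 𝒪(W)` of weight `λₙ` is uniquely determined up to a
  scalar. We explicitly constructed `f` and (guided by computer calculations) proved that
  `f(⟨n,n,n⟩) ≠ 0`. Hence `λₙ ∈ S(⟨n,n,n⟩)`." (§10.18 carries out part 1 via Lemmas 10.10,
  10.11 and closes with "We omit the details of the proof of the second part of this lemma".)
* §3.4: "`S°(w) := {λ | V_λ(G)^* occurs in 𝒪(Gw)}` … clearly contains `S(w)`"; (3.1):
  "exhibiting some `λ ∈ S(w) ∖ S(v)` proves that `\overline{Gw}` is not contained in
  `\overline{Gv}`. If `v = ⟨m⟩`, this establishes the lower bound `R̲(w) > m`."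

## What is proved here (kernel; every `n ≥ 2`)

`isotypicSum_bi2011_kroneckerPow_unitTensor_eq_zero`: conjunct (ii), i.e. the triple isotypic
character sum of type `λₙ` KILLS `⟨n²+1⟩^{⊗ 2n²}`, and the reduction
`burgisserIkenmeyer2011_lemma_6_1_of_occurrence`: the named fact now follows from (and, by
`occurrence_of_burgisserIkenmeyer2011_lemma_6_1`, is equivalent to) its matrix-multiplication half
"`λₙ ∈ S(⟨n,n,n⟩)`", which is NOT proved here — its proof is omitted in print ("guided by computer
calculations").

## The printed proof and the road taken here

The printed route to (ii) is representation-theoretic (Thm. 4.4: the dimension of the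
`stab(⟨m⟩)`-invariants of `V_λ` as a sum over dominated weights `α`, then two straightening
computations) and proves the stronger ORBIT statement `λₙ ∉ S°(⟨n²+1⟩)`. For the CLOSURE
statement recorded in the tree a direct sign-reversing involution suffices, in the coordinates of
`MatMulOccurrenceObstructionsProofs.lean` (BI 2013, (4.2)); this is NOT the printed route.
Put `N = n²`, `d = 2N`, `r = N + 1`.

1. Occurrence ⇒ pairing (tree, `exists_pairing_ne_zero_of_isotypicSum₁₂₃_kroneckerPow_ne_zero`),
   highest-weight vectors are combinations of polytabloids (`exists_sum_smul_polytabloid_eq`), and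
   the pairing with a power of a restriction `(A⊗B⊗C)·⟨r⟩` expands over label maps
   `I : [d] → [r]` (`pairing_unitTensor_eq_sum`): it suffices that for all standard tableaux `T₁`
   of shape `(2N−3,1,1,1)`, `T₂, T₃` of shape `2^N` and all `r × r` matrices `A, B, C`,
   `∑_I ⟨⊗ a_I, e_{T₁}⟩ ⟨⊗ b_I, e_{T₂}⟩ ⟨⊗ c_I, e_{T₃}⟩ = 0` (§6).
2. (§4) A term with `I` can be non-zero only if `I` is injective on every column of each tableau
   (column antisymmetry, tree `sum_prod_mul_polytabloid_eq_zero_of_apply_eq`). `T₂` has two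
   columns, so every letter has at most two preimages, and a letter with two preimages ("double")
   has them in different columns of `T₂`, of `T₃`, and not both in the first column of `T₁`.
   There are `r = N+1` letters and `2N` positions, so at most two letters have fewer than two
   preimages; the first column of `T₁` has four cells with four distinct letters, hence carries
   two doubles `x ≠ y`, each with its second preimage in the arm (row `0`, columns `≥ 1`) of `T₁`.
3. (§2–§3) Exchanging the letters `x ↔ y` is the same as composing `I` with two disjoint position
   transpositions, which can be matched to the columns of each tableau separately: two
   same-column transpositions for `T₂` (sign `(−1)²`), two for `T₃` (`(−1)²`), and for `T₁` one
   transposition inside the first column (`−1`, tree `sum_prod_mul_polytabloid_comp_swap`) and one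
   exchanging two arm cells (`+1`: singleton columns in the same row,
   `sum_prod_mul_polytabloid_comp_swap_of_singleton_columns`). So the term changes sign.
4. (§5) The exchange is a fixed-point-free involution on the support of the sum (the set of good
   doubles on the first column of `T₁` is invariant), so the sum vanishes
   (`Finset.sum_involution`; the choice of the pair `(x, y)` is made once per invariant set).

## References

* [BurgisserIkenmeyer2011] P. Bürgisser, C. Ikenmeyer, *Geometric complexity theory and tensor
  rank*, STOC 2011 = arXiv:1011.1350, Lemma 6.1, Rem. 6.2, §3.4, (3.1), §10.18 (Lemmas 10.10,
  10.11).
* [BurgisserIkenmeyer2013] P. Bürgisser, C. Ikenmeyer, *Explicit lower bounds via geometric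
  complexity theory*, STOC 2013 = arXiv:1210.8368, §4.2 (4.2) and Prop. 4.2 (the expansion over
  label maps and column antisymmetry used here).
* [BurgisserIkenmeyerPanovaJAMS2019] P. Bürgisser, C. Ikenmeyer, G. Panova, J. Amer. Math. Soc. 32
  (2019), Prop. 3.3 and (3.5) (polytabloids span the highest-weight vectors; column transpositions
  act by `−1`).

## Tree

`UnitTensorSLObstructions` (`bi2011TwoRect`, `bi2011Last`, `burgisserIkenmeyer2011_lemma_6_1`),
`MatMulOccurrenceObstructionsProofs` (`pairing_unitTensor_eq_sum`,
`sum_prod_mul_polytabloid_comp_swap`, `sum_prod_mul_polytabloid_eq_zero_of_apply_eq`,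
`sum_prod_mul_sum_smul_polytabloid`), `IsotypicOccurrenceSemigroup`
(`exists_pairing_ne_zero_of_isotypicSum₁₂₃_kroneckerPow_ne_zero`), `PlethysmStability`
(`exists_sum_smul_polytabloid_eq`), `SchurWeylPlethysmHwMultiplicityProofs` (`StdFilling`,
`polytabloid`, `polytabloid_apply`, `mem_colStab`), `PartitionTableaux`
(`Nat.Partition.youngDiagram`, `sortedParts`), `AsymptoticSpectrum` (`unitTensor`, `kroneckerPow`).
Mathlib: `Finset.sum_involution`, `Finset.card_eq_two`, `Finset.card_eq_sum_card_fiberwise`,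
`Equiv.swap`.
-/

noncomputable section

open scoped BigOperators

namespace Literature.Computability.AlgebraicComplexity

open Literature.NumberTheory.DiophantineGeometry (Word wordRep wordPerm wordPerm_apply
  highestWeightSpace Weight StdFilling ydWeight ydWeight_youngDiagram fst_lt_of_mem_youngDiagram)

/-! ## §1 The two Young diagrams of `λₙ`: `2^{n²}` (two columns of height `n²`) and `(2n²−3, 1, 1, 1)` -/

section Shapes

variable {n : ℕ}

/-- The sorted parts of `2^{n²} ⊢ 2n²` are `n²` twos. [cite: BurgisserIkenmeyer2011, Lemma 6.1] -/
theorem sortedParts_bi2011TwoRect (n : ℕ) :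
    (bi2011TwoRect n).sortedParts = List.replicate (n ^ 2) 2 := by
  have hperm : (bi2011TwoRect n).sortedParts.Perm (List.replicate (n ^ 2) 2) := by
    rw [← Multiset.coe_eq_coe, Nat.Partition.sortedParts, Multiset.sort_eq, bi2011TwoRect_parts,
      Multiset.coe_replicate]
  refine hperm.eq_of_sortedGE (bi2011TwoRect n).sortedGE_sortedParts ?_
  refine List.Pairwise.sortedGE ?_
  exact List.pairwise_replicate.2 (Or.inr le_rfl)

/-- The cells of the diagram of `2^{n²}`: `(i, j)` with `i < n²` and `j < 2` (two columns of
height `n²`). [cite: BurgisserIkenmeyer2011, Lemma 6.1] -/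
theorem mem_youngDiagram_bi2011TwoRect {x : ℕ × ℕ} :
    x ∈ (bi2011TwoRect n).youngDiagram ↔ x.1 < n ^ 2 ∧ x.2 < 2 := by
  rw [Nat.Partition.mem_youngDiagram_iff, sortedParts_bi2011TwoRect]
  simp only [List.length_replicate, List.getElem_replicate]
  exact ⟨fun ⟨h1, h2⟩ => ⟨h1, h2⟩, fun ⟨h1, h2⟩ => ⟨h1, h2⟩⟩

/-- Every entry of a standard tableau of shape `2^{n²}` lies in column `0` or column `1`.
[cite: BurgisserIkenmeyer2011, Lemma 6.1] -/
theorem snd_lt_two_of_twoRect {d : ℕ} (T : StdFilling d (bi2011TwoRect n).youngDiagram)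
    (p : Fin d) : (T.1 p).2 < 2 :=
  (mem_youngDiagram_bi2011TwoRect.1 (T.mem p)).2

/-- The sorted parts of `(2n²−3, 1, 1, 1) ⊢ 2n²` (`n ≥ 2`) are `2n²−3, 1, 1, 1`.
[cite: BurgisserIkenmeyer2011, Lemma 6.1] -/
theorem sortedParts_bi2011Last (n : ℕ) (hn : 2 ≤ n) :
    (bi2011Last n hn).sortedParts = (2 * n ^ 2 - 3) :: List.replicate 3 1 := by
  have h4 : 4 ≤ n ^ 2 := by nlinarith
  have hperm : (bi2011Last n hn).sortedParts.Perm ((2 * n ^ 2 - 3) :: List.replicate 3 1) := by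
    rw [← Multiset.coe_eq_coe, Nat.Partition.sortedParts, Multiset.sort_eq, bi2011Last_parts,
      ← Multiset.cons_coe, Multiset.coe_replicate, Multiset.singleton_add]
  refine hperm.eq_of_sortedGE (bi2011Last n hn).sortedGE_sortedParts ?_
  refine List.Pairwise.sortedGE (List.pairwise_cons.2 ⟨fun b hb => ?_, ?_⟩)
  · rw [List.eq_of_mem_replicate hb]
    omega
  · exact List.pairwise_replicate.2 (Or.inr le_rfl)

/-- The cells of the diagram of `(2n²−3, 1, 1, 1)`: row `0` has the cells `(0, c)`, `c < 2n²−3`,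
and rows `1, 2, 3` have the single cell `(r, 0)`. [cite: BurgisserIkenmeyer2011, Lemma 6.1] -/
theorem mem_youngDiagram_bi2011Last {hn : 2 ≤ n} {x : ℕ × ℕ} :
    x ∈ (bi2011Last n hn).youngDiagram ↔
      (x.1 = 0 ∧ x.2 < 2 * n ^ 2 - 3) ∨ (0 < x.1 ∧ x.1 < 4 ∧ x.2 = 0) := by
  rw [Nat.Partition.mem_youngDiagram_iff, sortedParts_bi2011Last]
  obtain ⟨r, c⟩ := x
  rcases r with _ | r
  · simp
  · simp only [List.length_cons, List.length_replicate, List.getElem_cons_succ,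
      List.getElem_replicate, Nat.lt_one_iff, Nat.succ_pos', true_and]
    constructor
    · rintro ⟨h, hc⟩
      exact Or.inr ⟨by omega, hc⟩
    · rintro (⟨h, _⟩ | ⟨h, hc⟩)
      · exact absurd h (Nat.succ_ne_zero r)
      · exact ⟨by omega, hc⟩

/-- In the diagram of `(2n²−3, 1, 1, 1)` every cell outside the first column lies in row `0`
(the arm). [cite: BurgisserIkenmeyer2011, Lemma 6.1] -/
theorem fst_eq_zero_of_snd_ne_zero_last {hn : 2 ≤ n} {x : ℕ × ℕ}
    (hx : x ∈ (bi2011Last n hn).youngDiagram) (h : x.2 ≠ 0) : x.1 = 0 := by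
  rcases mem_youngDiagram_bi2011Last.1 hx with ⟨h0, _⟩ | ⟨_, _, h2⟩
  · exact h0
  · exact absurd h2 h

/-- The first column of the diagram of `(2n²−3, 1, 1, 1)` consists of the four cells `(r, 0)`,
`r < 4` (`n ≥ 2`, so `2n² − 3 ≥ 1`). [cite: BurgisserIkenmeyer2011, Lemma 6.1] -/
theorem mk_zero_mem_youngDiagram_bi2011Last {hn : 2 ≤ n} {r : ℕ} (hr : r < 4) :
    (r, 0) ∈ (bi2011Last n hn).youngDiagram := by
  have h4 : 4 ≤ n ^ 2 := by nlinarith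
  rw [mem_youngDiagram_bi2011Last]
  rcases Nat.eq_zero_or_pos r with h | h
  · exact Or.inl ⟨h, by simp only; omega⟩
  · exact Or.inr ⟨h, hr, rfl⟩

/-- In a standard tableau of shape `(2n²−3, 1, 1, 1)` two entries in the same column outside the
first column coincide (those columns are singletons). [cite: BurgisserIkenmeyer2011, Lemma 6.1] -/
theorem eq_of_snd_eq_of_snd_ne_zero {hn : 2 ≤ n} {d : ℕ}
    (T : StdFilling d (bi2011Last n hn).youngDiagram) {p q : Fin d}
    (hpq : (T.1 p).2 = (T.1 q).2) (hp : (T.1 p).2 ≠ 0) : p = q := by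
  apply T.injective
  refine Prod.ext ?_ hpq
  rw [fst_eq_zero_of_snd_ne_zero_last (T.mem p) hp,
    fst_eq_zero_of_snd_ne_zero_last (T.mem q) (by rw [← hpq]; exact hp)]

/-- A standard tableau of shape `(2n²−3, 1, 1, 1)` on `2n²` entries has at least four entries in
its first column (one on each cell `(r, 0)`, `r < 4`). [cite: BurgisserIkenmeyer2011, Lemma 6.1] -/
theorem four_le_card_filter_snd_eq_zero {hn : 2 ≤ n}
    (T : StdFilling (2 * n ^ 2) (bi2011Last n hn).youngDiagram) :
    4 ≤ (Finset.univ.filter fun p => (T.1 p).2 = 0).card := by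
  classical
  have hd : (bi2011Last n hn).youngDiagram.cells.card = 2 * n ^ 2 :=
    Nat.Partition.card_cells_youngDiagram _
  have hex : ∀ r ∈ Finset.range 4, ∃ p : Fin (2 * n ^ 2), T.1 p = (r, 0) := fun r hr =>
    T.exists_eq hd (mk_zero_mem_youngDiagram_bi2011Last (Finset.mem_range.1 hr))
  have h4 : 4 ≤ n ^ 2 := by nlinarith
  haveI : Nonempty (Fin (2 * n ^ 2)) := ⟨⟨0, by omega⟩⟩
  choose! g hg using hex
  calc 4 = (Finset.range 4).card := (Finset.card_range _).symm
    _ ≤ (Finset.univ.filter fun p => (T.1 p).2 = 0).card := by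
      refine Finset.card_le_card_of_injOn g (fun r hr => ?_) (fun r₁ hr₁ r₂ hr₂ h => ?_)
      · simp only [Finset.coe_filter, Finset.mem_univ, true_and, Set.mem_setOf_eq, hg r hr]
      · have h₁ := hg r₁ hr₁
        rw [h, hg r₂ hr₂] at h₁
        exact (Prod.mk.inj h₁).1.symm

end Shapes

/-! ## §2 Exchanging two arm cells of a hook-like tableau does not change the elementary pairing -/

section Arm

variable {N d : ℕ} {Y : YoungDiagram}

/-- If two entries `a, b` of a standard tableau `T` lie in the same row and are each the only
entry of their column, then the polytabloid `e_T` is invariant under exchanging the letters at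
`a` and `b`: every `σ ∈ C_T` fixes `a` and `b`, so `(a b)` commutes with `C_T` and fixes the row
word. Fulton, *Young Tableaux*, §7.2. [cite: BurgisserIkenmeyerPanovaJAMS2019, §3(b)] -/
theorem polytabloid_comp_swap_of_singleton_columns (hN : ∀ x ∈ Y.cells, x.1 < N)
    (T : StdFilling d Y) {a b : Fin d} (hrow : (T.1 a).1 = (T.1 b).1)
    (ha : ∀ q, (T.1 q).2 = (T.1 a).2 → q = a) (hb : ∀ q, (T.1 q).2 = (T.1 b).2 → q = b)
    (u : Word N d) :
    T.polytabloid ℂ hN (u ∘ ⇑(Equiv.swap a b)) = T.polytabloid ℂ hN u := by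
  classical
  rw [StdFilling.polytabloid_apply, StdFilling.polytabloid_apply]
  refine Finset.sum_congr rfl fun σ hσ => ?_
  have hσa : σ⁻¹ a = a := ha _ ((StdFilling.mem_colStab.1 (StdFilling.inv_mem_colStab hσ)) a)
  have hσb : σ⁻¹ b = b := hb _ ((StdFilling.mem_colStab.1 (StdFilling.inv_mem_colStab hσ)) b)
  -- the row word is constant on `{a, b}` and `σ⁻¹` commutes with `(a b)`
  have hrw : ∀ m, T.rowWord hN (σ⁻¹ (Equiv.swap a b m)) = T.rowWord hN (σ⁻¹ m) := by
    intro m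
    rcases eq_or_ne m a with rfl | hma
    · rw [Equiv.swap_apply_left, hσa, hσb]
      exact Fin.ext (by rw [StdFilling.rowWord_val, StdFilling.rowWord_val, hrow])
    rcases eq_or_ne m b with rfl | hmb
    · rw [Equiv.swap_apply_right, hσa, hσb]
      exact Fin.ext (by rw [StdFilling.rowWord_val, StdFilling.rowWord_val, hrow])
    · rw [Equiv.swap_apply_of_ne_of_ne hma hmb]
  have hiff : (u ∘ ⇑(Equiv.swap a b) = T.rowWord hN ∘ ⇑σ⁻¹) ↔ (u = T.rowWord hN ∘ ⇑σ⁻¹) := by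
    constructor
    · intro h
      funext m
      have hm := congrFun h (Equiv.swap a b m)
      simp only [Function.comp_apply, Equiv.swap_apply_self] at hm
      rw [hm, hrw, Function.comp_apply]
    · intro h
      funext m
      rw [Function.comp_apply, h, Function.comp_apply, Function.comp_apply, hrw]
  simp only [hiff]

/-- **Exchanging the labels of two arm cells.** For a standard tableau `T` and two entries `a, b`
in the same row which are each alone in their column, the elementary pairing
`⟨⊗_m x_{I m}, e_T⟩` is unchanged when the labels of `a` and `b` are exchanged:
`⟨⊗_m x_{I((a b) m)}, e_T⟩ = ⟨⊗_m x_{I m}, e_T⟩`. (Companion of the tree's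
`sum_prod_mul_polytabloid_comp_swap`, where `a, b` share a column and the sign is `−1`.)
[cite: BurgisserIkenmeyer2013, §4.2 (4.2)] -/
theorem sum_prod_mul_polytabloid_comp_swap_of_singleton_columns (hN : ∀ x ∈ Y.cells, x.1 < N)
    (T : StdFilling d Y) {a b : Fin d} (hrow : (T.1 a).1 = (T.1 b).1)
    (ha : ∀ q, (T.1 q).2 = (T.1 a).2 → q = a) (hb : ∀ q, (T.1 q).2 = (T.1 b).2 → q = b)
    (M : Matrix (Fin N) (Fin N) ℂ) (I : Fin d → Fin N) :
    ∑ u : Word N d, (∏ m, M (u m) (I (Equiv.swap a b m))) * T.polytabloid ℂ hN u =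
      ∑ u : Word N d, (∏ m, M (u m) (I m)) * T.polytabloid ℂ hN u := by
  set τ : Equiv.Perm (Fin d) := Equiv.swap a b with hτ_def
  -- reindex the left-hand sum by `u ↦ u ∘ τ`
  have hre : ∑ u : Word N d, (∏ m, M (u m) (I (τ m))) * T.polytabloid ℂ hN u =
      ∑ u : Word N d, (∏ m, M ((u ∘ ⇑τ) m) (I (τ m))) * T.polytabloid ℂ hN (u ∘ ⇑τ) := by
    refine Fintype.sum_equiv (Equiv.arrowCongr τ (Equiv.refl (Fin N))) _ _ fun u => ?_
    have hu : ((Equiv.arrowCongr τ (Equiv.refl (Fin N))) u) ∘ ⇑τ = u := by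
      funext m
      simp [Equiv.arrowCongr_apply]
    rw [hu]
  rw [hre]
  refine Finset.sum_congr rfl fun u _ => ?_
  rw [hτ_def, polytabloid_comp_swap_of_singleton_columns hN T hrow ha hb u]
  congr 1
  exact Equiv.prod_comp τ (fun m => M (u m) (I m))

end Arm

/-! ## §3 Exchanging two letters with two preimages each = two position transpositions -/

section LetterSwap

variable {d r : ℕ}

/-- If the letters `x ≠ y` have exactly the preimages `{p₀, p₁}` and `{q₀, q₁}` under
`I : [d] → [r]`, then exchanging the letters `x ↔ y` after `I` is the same as exchanging the
positions `p₀ ↔ q₀` and `p₁ ↔ q₁` before `I` (any matching of the two fibres will do).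
(Private: plumbing used only in this file.) [folklore] -/
private theorem swap_comp_eq_comp_swap_swap (I : Fin d → Fin r) {x y : Fin r} (hxy : x ≠ y)
    {p₀ p₁ q₀ q₁ : Fin d} (hp : p₀ ≠ p₁) (hq : q₀ ≠ q₁)
    (hx : ∀ m, I m = x ↔ (m = p₀ ∨ m = p₁)) (hy : ∀ m, I m = y ↔ (m = q₀ ∨ m = q₁)) :
    ⇑(Equiv.swap x y) ∘ I = I ∘ ⇑(Equiv.swap p₀ q₀) ∘ ⇑(Equiv.swap p₁ q₁) := by
  have hIp₀ : I p₀ = x := (hx p₀).2 (Or.inl rfl)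
  have hIp₁ : I p₁ = x := (hx p₁).2 (Or.inr rfl)
  have hIq₀ : I q₀ = y := (hy q₀).2 (Or.inl rfl)
  have hIq₁ : I q₁ = y := (hy q₁).2 (Or.inr rfl)
  -- the two fibres are disjoint
  have hp₀q₀ : p₀ ≠ q₀ := fun h => hxy (by rw [← hIp₀, h, hIq₀])
  have hp₀q₁ : p₀ ≠ q₁ := fun h => hxy (by rw [← hIp₀, h, hIq₁])
  have hp₁q₀ : p₁ ≠ q₀ := fun h => hxy (by rw [← hIp₁, h, hIq₀])
  have hp₁q₁ : p₁ ≠ q₁ := fun h => hxy (by rw [← hIp₁, h, hIq₁])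
  funext m
  simp only [Function.comp_apply]
  rcases eq_or_ne m p₁ with rfl | hm₁
  · rw [Equiv.swap_apply_left, Equiv.swap_apply_of_ne_of_ne hp₀q₁.symm hq.symm, hIq₁, hIp₁,
      Equiv.swap_apply_left]
  rcases eq_or_ne m q₁ with rfl | hm₂
  · rw [Equiv.swap_apply_right, Equiv.swap_apply_of_ne_of_ne hp.symm hp₁q₀, hIp₁, hIq₁,
      Equiv.swap_apply_right]
  rw [Equiv.swap_apply_of_ne_of_ne hm₁ hm₂]
  rcases eq_or_ne m p₀ with rfl | hm₃
  · rw [Equiv.swap_apply_left, hIq₀, hIp₀, Equiv.swap_apply_left]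
  rcases eq_or_ne m q₀ with rfl | hm₄
  · rw [Equiv.swap_apply_right, hIp₀, hIq₀, Equiv.swap_apply_right]
  rw [Equiv.swap_apply_of_ne_of_ne hm₃ hm₄]
  have hmx : I m ≠ x := fun h => by
    rcases (hx m).1 h with h' | h'
    · exact hm₃ h'
    · exact hm₁ h'
  have hmy : I m ≠ y := fun h => by
    rcases (hy m).1 h with h' | h'
    · exact hm₄ h'
    · exact hm₂ h'
  rw [Equiv.swap_apply_of_ne_of_ne hmx hmy]

end LetterSwap

/-! ## §4 The sign of a term under the exchange of two good double letters -/

section Flip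

variable {n d r : ℕ} {hn : 2 ≤ n}

/-- **The `2^{n²}`-factors are invariant.** Let `T` be a standard tableau of shape `2^{n²}` and
let the letters `x ≠ y` have exactly two preimages each under `I`, `{p₀, p₁}` and `{q₀, q₁}`,
lying in different columns of `T` (`T` has only the columns `0` and `1`). Then exchanging
`x ↔ y` is composing `I` with two same-column transpositions of `T`, so the elementary pairing
`⟨⊗_m b_{I m}, e_T⟩` is unchanged (sign `(−1)²`, tree `sum_prod_mul_polytabloid_comp_swap`).
[cite: BurgisserIkenmeyer2011, Lemma 6.1] -/
theorem twoRect_pairing_letterSwap (hN : ∀ c ∈ (bi2011TwoRect n).youngDiagram.cells, c.1 < r)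
    (T : StdFilling d (bi2011TwoRect n).youngDiagram) (M : Matrix (Fin r) (Fin r) ℂ)
    (I : Fin d → Fin r) {x y : Fin r} (hxy : x ≠ y) {p₀ p₁ q₀ q₁ : Fin d} (hp : p₀ ≠ p₁)
    (hq : q₀ ≠ q₁) (hx : ∀ m, I m = x ↔ (m = p₀ ∨ m = p₁)) (hy : ∀ m, I m = y ↔ (m = q₀ ∨ m = q₁))
    (hpT : (T.1 p₀).2 ≠ (T.1 p₁).2) (hqT : (T.1 q₀).2 ≠ (T.1 q₁).2) :
    ∑ u : Word r d, (∏ m, M (u m) ((⇑(Equiv.swap x y) ∘ I) m)) * T.polytabloid ℂ hN u =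
      ∑ u : Word r d, (∏ m, M (u m) (I m)) * T.polytabloid ℂ hN u := by
  have hIp₀ : I p₀ = x := (hx p₀).2 (Or.inl rfl)
  have hIp₁ : I p₁ = x := (hx p₁).2 (Or.inr rfl)
  have hIq₀ : I q₀ = y := (hy q₀).2 (Or.inl rfl)
  have hIq₁ : I q₁ = y := (hy q₁).2 (Or.inr rfl)
  have hp₀q₀ : p₀ ≠ q₀ := fun h => hxy (by rw [← hIp₀, h, hIq₀])
  have hp₀q₁ : p₀ ≠ q₁ := fun h => hxy (by rw [← hIp₀, h, hIq₁])
  have hp₁q₀ : p₁ ≠ q₀ := fun h => hxy (by rw [← hIp₁, h, hIq₀])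
  have hp₁q₁ : p₁ ≠ q₁ := fun h => hxy (by rw [← hIp₁, h, hIq₁])
  have b₁ := snd_lt_two_of_twoRect T p₀
  have b₂ := snd_lt_two_of_twoRect T p₁
  have b₃ := snd_lt_two_of_twoRect T q₀
  have b₄ := snd_lt_two_of_twoRect T q₁
  by_cases hc : (T.1 p₀).2 = (T.1 q₀).2
  · -- match `p₀ ↔ q₀`, `p₁ ↔ q₁`
    have hc' : (T.1 p₁).2 = (T.1 q₁).2 := by omega
    rw [swap_comp_eq_comp_swap_swap I hxy hp hq hx hy]
    have h1 := sum_prod_mul_polytabloid_comp_swap hN T hp₁q₁ hc' M (I ∘ ⇑(Equiv.swap p₀ q₀))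
    have h0 := sum_prod_mul_polytabloid_comp_swap hN T hp₀q₀ hc M I
    simp only [Function.comp_apply] at h1 h0 ⊢
    rw [h1, h0, neg_neg]
  · -- match `p₀ ↔ q₁`, `p₁ ↔ q₀`
    have hc₁ : (T.1 p₀).2 = (T.1 q₁).2 := by omega
    have hc₂ : (T.1 p₁).2 = (T.1 q₀).2 := by omega
    rw [swap_comp_eq_comp_swap_swap I hxy hp hq.symm hx (fun m => (hy m).trans or_comm)]
    have h1 := sum_prod_mul_polytabloid_comp_swap hN T hp₁q₀ hc₂ M (I ∘ ⇑(Equiv.swap p₀ q₁))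
    have h0 := sum_prod_mul_polytabloid_comp_swap hN T hp₀q₁ hc₁ M I
    simp only [Function.comp_apply] at h1 h0 ⊢
    rw [h1, h0, neg_neg]

/-- **The `(2n²−3,1,1,1)`-factor changes sign.** Let `T` be a standard tableau of shape
`(2n²−3, 1, 1, 1)` and let the letters `x ≠ y` have exactly two preimages each under `I`,
`{p₀, p₁}` and `{q₀, q₁}`, with `p₀, q₀` in the first column of `T` and `p₁, q₁` in its arm. Then
exchanging `x ↔ y` is composing `I` with the first-column transposition `(p₀ q₀)` (sign `−1`)
and the exchange `(p₁ q₁)` of two arm cells (sign `+1`), so `⟨⊗_m a_{I m}, e_T⟩` changes sign.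
[cite: BurgisserIkenmeyer2011, Lemma 6.1] -/
theorem last_pairing_letterSwap (hN : ∀ c ∈ (bi2011Last n hn).youngDiagram.cells, c.1 < r)
    (T : StdFilling d (bi2011Last n hn).youngDiagram) (M : Matrix (Fin r) (Fin r) ℂ)
    (I : Fin d → Fin r) {x y : Fin r} (hxy : x ≠ y) {p₀ p₁ q₀ q₁ : Fin d} (hp : p₀ ≠ p₁)
    (hq : q₀ ≠ q₁) (hx : ∀ m, I m = x ↔ (m = p₀ ∨ m = p₁)) (hy : ∀ m, I m = y ↔ (m = q₀ ∨ m = q₁))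
    (hp₀ : (T.1 p₀).2 = 0) (hp₁ : (T.1 p₁).2 ≠ 0) (hq₀ : (T.1 q₀).2 = 0) (hq₁ : (T.1 q₁).2 ≠ 0) :
    ∑ u : Word r d, (∏ m, M (u m) ((⇑(Equiv.swap x y) ∘ I) m)) * T.polytabloid ℂ hN u =
      -∑ u : Word r d, (∏ m, M (u m) (I m)) * T.polytabloid ℂ hN u := by
  have hIp₀ : I p₀ = x := (hx p₀).2 (Or.inl rfl)
  have hIq₀ : I q₀ = y := (hy q₀).2 (Or.inl rfl)
  have hp₀q₀ : p₀ ≠ q₀ := fun h => hxy (by rw [← hIp₀, h, hIq₀])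
  -- the two arm cells lie in row `0` and are alone in their columns
  have hrow : (T.1 p₁).1 = (T.1 q₁).1 := by
    rw [fst_eq_zero_of_snd_ne_zero_last (T.mem p₁) hp₁, fst_eq_zero_of_snd_ne_zero_last (T.mem q₁) hq₁]
  have ha : ∀ q, (T.1 q).2 = (T.1 p₁).2 → q = p₁ := fun q h =>
    eq_of_snd_eq_of_snd_ne_zero T h (by rw [h]; exact hp₁)
  have hb : ∀ q, (T.1 q).2 = (T.1 q₁).2 → q = q₁ := fun q h =>
    eq_of_snd_eq_of_snd_ne_zero T h (by rw [h]; exact hq₁)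
  rw [swap_comp_eq_comp_swap_swap I hxy hp hq hx hy]
  have h1 := sum_prod_mul_polytabloid_comp_swap_of_singleton_columns hN T hrow ha hb M
    (I ∘ ⇑(Equiv.swap p₀ q₀))
  have h0 := sum_prod_mul_polytabloid_comp_swap hN T hp₀q₀ (hp₀.trans hq₀.symm) M I
  simp only [Function.comp_apply] at h1 h0 ⊢
  rw [h1, h0]

/-- **A term of the expanded pairing changes sign under the exchange of two good doubles.** For
standard tableaux `T₁` of shape `(2n²−3,1,1,1)`, `T₂, T₃` of shape `2^{n²}`, matrices `A, B, C`
and a label map `I`, call a letter `x` a *good double* if it has exactly two preimages `p₀, p₁`,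
with `p₀` in the first column and `p₁` in the arm of `T₁`, and in different columns of `T₂` and
of `T₃`. For two good doubles `x ≠ y` the term
`⟨⊗ a_I, e_{T₁}⟩ ⟨⊗ b_I, e_{T₂}⟩ ⟨⊗ c_I, e_{T₃}⟩` of `I` and the term of `(x y) ∘ I` are opposite.
[cite: BurgisserIkenmeyer2011, Lemma 6.1] -/
theorem tripleTerm_letterSwap (hN₁ : ∀ c ∈ (bi2011Last n hn).youngDiagram.cells, c.1 < r)
    (hN₂ : ∀ c ∈ (bi2011TwoRect n).youngDiagram.cells, c.1 < r)
    (T₁ : StdFilling d (bi2011Last n hn).youngDiagram)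
    (T₂ T₃ : StdFilling d (bi2011TwoRect n).youngDiagram) (A B C : Matrix (Fin r) (Fin r) ℂ)
    (I : Fin d → Fin r) {x y : Fin r} (hxy : x ≠ y)
    (hx : ∃ p₀ p₁ : Fin d, p₀ ≠ p₁ ∧ (∀ m, I m = x ↔ (m = p₀ ∨ m = p₁)) ∧ (T₁.1 p₀).2 = 0 ∧
      (T₁.1 p₁).2 ≠ 0 ∧ (T₂.1 p₀).2 ≠ (T₂.1 p₁).2 ∧ (T₃.1 p₀).2 ≠ (T₃.1 p₁).2)
    (hy : ∃ q₀ q₁ : Fin d, q₀ ≠ q₁ ∧ (∀ m, I m = y ↔ (m = q₀ ∨ m = q₁)) ∧ (T₁.1 q₀).2 = 0 ∧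
      (T₁.1 q₁).2 ≠ 0 ∧ (T₂.1 q₀).2 ≠ (T₂.1 q₁).2 ∧ (T₃.1 q₀).2 ≠ (T₃.1 q₁).2) :
    (∑ u : Word r d, (∏ m, A (u m) ((⇑(Equiv.swap x y) ∘ I) m)) * T₁.polytabloid ℂ hN₁ u) *
        (∑ v : Word r d, (∏ m, B (v m) ((⇑(Equiv.swap x y) ∘ I) m)) * T₂.polytabloid ℂ hN₂ v) *
        (∑ w : Word r d, (∏ m, C (w m) ((⇑(Equiv.swap x y) ∘ I) m)) * T₃.polytabloid ℂ hN₂ w) =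
      -((∑ u : Word r d, (∏ m, A (u m) (I m)) * T₁.polytabloid ℂ hN₁ u) *
        (∑ v : Word r d, (∏ m, B (v m) (I m)) * T₂.polytabloid ℂ hN₂ v) *
        (∑ w : Word r d, (∏ m, C (w m) (I m)) * T₃.polytabloid ℂ hN₂ w)) := by
  obtain ⟨p₀, p₁, hp, hfx, hp₀, hp₁, hp2, hp3⟩ := hx
  obtain ⟨q₀, q₁, hq, hfy, hq₀, hq₁, hq2, hq3⟩ := hy
  rw [last_pairing_letterSwap hN₁ T₁ A I hxy hp hq hfx hfy hp₀ hp₁ hq₀ hq₁,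
    twoRect_pairing_letterSwap hN₂ T₂ B I hxy hp hq hfx hfy hp2 hq2,
    twoRect_pairing_letterSwap hN₂ T₃ C I hxy hp hq hfx hfy hp3 hq3]
  ring

end Flip

/-! ## §5 A sign-reversing involution given by exchanging two letters -/

section Involution

variable {d r : ℕ}

/-- **Letter-exchange involution.** Let `F` be a function of label maps `I : [d] → [r]` and
`G I` a set of letters ("good letters of `I`") such that: exchanging two good letters `x ≠ y`
preserves the set of good letters and negates `F`; good letters are values of `I`; and every
`I` with `F I ≠ 0` has two distinct good letters. Then `∑_I F I = 0` — the exchange of a chosen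
pair of good letters (the choice depending only on the set `G I`) is a fixed-point-free
involution on the support of `F` reversing the sign (`Finset.sum_involution`). (Private: plumbing used
only in this file.) [folklore] -/
private theorem sum_eq_zero_of_letterSwap (F : (Fin d → Fin r) → ℂ) (G : (Fin d → Fin r) → Fin r → Prop)
    (hG : ∀ I (x y : Fin r), x ≠ y → G I x → G I y → ∀ ℓ, G (⇑(Equiv.swap x y) ∘ I) ℓ ↔ G I ℓ)
    (hflip : ∀ I (x y : Fin r), x ≠ y → G I x → G I y → F (⇑(Equiv.swap x y) ∘ I) = -F I)
    (himg : ∀ I x, G I x → ∃ m, I m = x)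
    (hsupp : ∀ I, F I ≠ 0 → ∃ x y, x ≠ y ∧ G I x ∧ G I y) :
    ∑ I, F I = 0 := by
  classical
  -- the chosen pair depends only on the predicate `G I`
  have key : ∀ (P P' : Fin r → Prop) (_ : P = P') (h : ∃ x y, x ≠ y ∧ P x ∧ P y)
      (h' : ∃ x y, x ≠ y ∧ P' x ∧ P' y),
      Equiv.swap h.choose h.choose_spec.choose = Equiv.swap h'.choose h'.choose_spec.choose := by
    intro P P' e h h'
    subst e
    rfl
  have hmem : ∀ {I}, I ∈ (Finset.univ.filter fun I => F I ≠ 0) → F I ≠ 0 := fun hI =>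
    (Finset.mem_filter.1 hI).2
  rw [← Finset.sum_filter_ne_zero]
  refine Finset.sum_involution
    (fun I hI => ⇑(Equiv.swap (hsupp I (hmem hI)).choose
      (hsupp I (hmem hI)).choose_spec.choose) ∘ I) ?_ ?_ ?_ ?_
  · -- `F I + F (g I) = 0`
    intro I hI
    obtain ⟨hxy, hGx, hGy⟩ := (hsupp I (hmem hI)).choose_spec.choose_spec
    rw [hflip I _ _ hxy hGx hGy, add_neg_cancel]
  · -- `g I ≠ I`
    intro I hI _ hEq
    obtain ⟨hxy, hGx, -⟩ := (hsupp I (hmem hI)).choose_spec.choose_spec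
    obtain ⟨m, hm⟩ := himg I _ hGx
    have h := congrFun hEq m
    simp only [Function.comp_apply, hm, Equiv.swap_apply_left] at h
    exact hxy h.symm
  · -- `g I` stays in the support
    intro I hI
    obtain ⟨hxy, hGx, hGy⟩ := (hsupp I (hmem hI)).choose_spec.choose_spec
    refine Finset.mem_filter.2 ⟨Finset.mem_univ _, ?_⟩
    rw [hflip I _ _ hxy hGx hGy, neg_ne_zero]
    exact hmem hI
  · -- `g (g I) = I`: the same pair is chosen for `g I`
    intro I hI
    obtain ⟨hxy, hGx, hGy⟩ := (hsupp I (hmem hI)).choose_spec.choose_spec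
    set x := (hsupp I (hmem hI)).choose with hx_def
    set y := (hsupp I (hmem hI)).choose_spec.choose with hy_def
    have hI' : ⇑(Equiv.swap x y) ∘ I ∈ Finset.univ.filter fun I => F I ≠ 0 := by
      refine Finset.mem_filter.2 ⟨Finset.mem_univ _, ?_⟩
      rw [hflip I _ _ hxy hGx hGy, neg_ne_zero]
      exact hmem hI
    have e : G (⇑(Equiv.swap x y) ∘ I) = G I :=
      funext fun ℓ => propext (hG I x y hxy hGx hGy ℓ)
    have hk := key _ _ e (hsupp _ (hmem hI')) (hsupp I (hmem hI))
    show ⇑(Equiv.swap (hsupp _ (hmem hI')).choose (hsupp _ (hmem hI')).choose_spec.choose) ∘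
      (⇑(Equiv.swap x y) ∘ I) = I
    rw [hk]
    funext m
    exact Equiv.swap_apply_self _ _ _

end Involution

/-! ## §6 The support of the expanded pairing: two good doubles on the first column of `T₁` -/

section Support

variable {n : ℕ} {hn : 2 ≤ n}

/-- **Structure of a non-vanishing term** (`N = n²`, `d = 2N`, `r = N + 1`). If the term
`⟨⊗ a_I, e_{T₁}⟩ ⟨⊗ b_I, e_{T₂}⟩ ⟨⊗ c_I, e_{T₃}⟩` of a label map `I : [2N] → [N+1]` is non-zero
(`T₁` standard of shape `(2N−3,1,1,1)`, `T₂, T₃` standard of shape `2^N`), then `I` is injective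
on the columns of each tableau; as `T₂` has two columns every letter has `≤ 2` preimages, at most
two of the `N + 1` letters have `≤ 1` preimage (`∑` of the fibre sizes is `2N`), and among the
`≥ 4` distinct letters on the first column of `T₁` two, `x ≠ y`, are good doubles: two preimages,
one on the first column and one on the arm of `T₁`, in different columns of `T₂` and of `T₃`.
[cite: BurgisserIkenmeyer2011, Lemma 6.1] -/
theorem exists_goodDoubles_of_tripleTerm_ne_zero
    (hN₁ : ∀ c ∈ (bi2011Last n hn).youngDiagram.cells, c.1 < n ^ 2 + 1)
    (hN₂ : ∀ c ∈ (bi2011TwoRect n).youngDiagram.cells, c.1 < n ^ 2 + 1)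
    (T₁ : StdFilling (2 * n ^ 2) (bi2011Last n hn).youngDiagram)
    (T₂ T₃ : StdFilling (2 * n ^ 2) (bi2011TwoRect n).youngDiagram)
    (A B C : Matrix (Fin (n ^ 2 + 1)) (Fin (n ^ 2 + 1)) ℂ) (I : Fin (2 * n ^ 2) → Fin (n ^ 2 + 1))
    (h : (∑ u : Word (n ^ 2 + 1) (2 * n ^ 2), (∏ m, A (u m) (I m)) * T₁.polytabloid ℂ hN₁ u) *
        (∑ v : Word (n ^ 2 + 1) (2 * n ^ 2), (∏ m, B (v m) (I m)) * T₂.polytabloid ℂ hN₂ v) *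
        (∑ w : Word (n ^ 2 + 1) (2 * n ^ 2), (∏ m, C (w m) (I m)) * T₃.polytabloid ℂ hN₂ w) ≠ 0) :
    ∃ x y : Fin (n ^ 2 + 1), x ≠ y ∧
      (∃ p₀ p₁ : Fin (2 * n ^ 2), p₀ ≠ p₁ ∧ (∀ m, I m = x ↔ (m = p₀ ∨ m = p₁)) ∧ (T₁.1 p₀).2 = 0 ∧
        (T₁.1 p₁).2 ≠ 0 ∧ (T₂.1 p₀).2 ≠ (T₂.1 p₁).2 ∧ (T₃.1 p₀).2 ≠ (T₃.1 p₁).2) ∧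
      (∃ q₀ q₁ : Fin (2 * n ^ 2), q₀ ≠ q₁ ∧ (∀ m, I m = y ↔ (m = q₀ ∨ m = q₁)) ∧ (T₁.1 q₀).2 = 0 ∧
        (T₁.1 q₁).2 ≠ 0 ∧ (T₂.1 q₀).2 ≠ (T₂.1 q₁).2 ∧ (T₃.1 q₀).2 ≠ (T₃.1 q₁).2) := by
  classical
  obtain ⟨⟨hP₁, hP₂⟩, hP₃⟩ := mul_ne_zero_iff.1 h |>.imp_left (mul_ne_zero_iff.1)
  -- injectivity of `I` on the columns of the three tableaux
  have inj₁ : ∀ p q, p ≠ q → (T₁.1 p).2 = (T₁.1 q).2 → I p ≠ I q := fun p q hpq hc hI =>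
    hP₁ (sum_prod_mul_polytabloid_eq_zero_of_apply_eq hN₁ T₁ hpq hc A hI)
  have inj₂ : ∀ p q, p ≠ q → (T₂.1 p).2 = (T₂.1 q).2 → I p ≠ I q := fun p q hpq hc hI =>
    hP₂ (sum_prod_mul_polytabloid_eq_zero_of_apply_eq hN₂ T₂ hpq hc B hI)
  have inj₃ : ∀ p q, p ≠ q → (T₃.1 p).2 = (T₃.1 q).2 → I p ≠ I q := fun p q hpq hc hI =>
    hP₃ (sum_prod_mul_polytabloid_eq_zero_of_apply_eq hN₂ T₃ hpq hc C hI)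
  -- fibres of `I`
  set fib : Fin (n ^ 2 + 1) → Finset (Fin (2 * n ^ 2)) :=
    fun ℓ => Finset.univ.filter fun m => I m = ℓ with hfib_def
  have mem_fib : ∀ {ℓ m}, m ∈ fib ℓ ↔ I m = ℓ := by
    intro ℓ m
    simp [hfib_def]
  -- every letter has at most two preimages (two columns of `T₂`)
  have hle2 : ∀ ℓ, (fib ℓ).card ≤ 2 := by
    intro ℓ
    by_contra hlt
    obtain ⟨a, b, c, ha, hb, hc, hab, hac, hbc⟩ := Finset.two_lt_card_iff.1 (not_le.1 hlt)
    rw [mem_fib] at ha hb hc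
    have h₁ := snd_lt_two_of_twoRect T₂ a
    have h₂ := snd_lt_two_of_twoRect T₂ b
    have h₃ := snd_lt_two_of_twoRect T₂ c
    by_cases e₁ : (T₂.1 a).2 = (T₂.1 b).2
    · exact inj₂ a b hab e₁ (ha.trans hb.symm)
    by_cases e₂ : (T₂.1 a).2 = (T₂.1 c).2
    · exact inj₂ a c hac e₂ (ha.trans hc.symm)
    exact inj₂ b c hbc (by omega) (hb.trans hc.symm)
  -- at most two letters have at most one preimage
  set S := Finset.univ.filter fun ℓ : Fin (n ^ 2 + 1) => (fib ℓ).card ≤ 1 with hS_def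
  have hsum : (Finset.univ : Finset (Fin (2 * n ^ 2))).card = ∑ ℓ, (fib ℓ).card :=
    Finset.card_eq_sum_card_fiberwise fun m _ => Finset.mem_univ (I m)
  have hS : S.card ≤ 2 := by
    have hterm : ∀ ℓ, (fib ℓ).card + (if (fib ℓ).card ≤ 1 then 1 else 0) ≤ 2 := by
      intro ℓ
      have := hle2 ℓ
      split_ifs with h1 <;> omega
    have hScard : S.card = ∑ ℓ, (if (fib ℓ).card ≤ 1 then 1 else 0) := by
      rw [hS_def, Finset.card_filter]
    have hbound : ∑ ℓ : Fin (n ^ 2 + 1), ((fib ℓ).card + (if (fib ℓ).card ≤ 1 then 1 else 0)) ≤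
        ∑ _ℓ : Fin (n ^ 2 + 1), 2 := Finset.sum_le_sum fun ℓ _ => hterm ℓ
    rw [Finset.sum_add_distrib, ← hsum, ← hScard, Finset.sum_const, Finset.card_univ,
      Fintype.card_fin, Finset.card_univ, Fintype.card_fin, smul_eq_mul] at hbound
    omega
  -- the first column of `T₁` and its (at least four, distinct) letters
  set col0 := Finset.univ.filter fun p : Fin (2 * n ^ 2) => (T₁.1 p).2 = 0 with hcol0_def
  have hinj0 : Set.InjOn I (col0 : Set (Fin (2 * n ^ 2))) := by
    intro p hp q hq hI
    simp only [hcol0_def, Finset.coe_filter, Finset.mem_univ, true_and, Set.mem_setOf_eq] at hp hq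
    by_contra hpq
    exact inj₁ p q hpq (hp.trans hq.symm) hI
  have h4 : 4 ≤ (col0.image I).card := by
    rw [Finset.card_image_of_injOn hinj0]
    exact four_le_card_filter_snd_eq_zero T₁
  -- the letters of the first column with two preimages
  set D := (col0.image I).filter fun ℓ => ¬ (fib ℓ).card ≤ 1 with hD_def
  have hD2 : 1 < D.card := by
    have hsplit := Finset.card_filter_add_card_filter_not
      (s := col0.image I) (fun ℓ => (fib ℓ).card ≤ 1)
    have hsub : ((col0.image I).filter fun ℓ => (fib ℓ).card ≤ 1) ⊆ S := by
      intro ℓ hℓ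
      rw [hS_def, Finset.mem_filter]
      exact ⟨Finset.mem_univ _, (Finset.mem_filter.1 hℓ).2⟩
    have := Finset.card_le_card hsub
    rw [hD_def]
    omega
  obtain ⟨x, hx, y, hy, hxy⟩ := Finset.one_lt_card.1 hD2
  -- a letter of `D` is a good double
  have good : ∀ ℓ ∈ D, ∃ p₀ p₁ : Fin (2 * n ^ 2), p₀ ≠ p₁ ∧ (∀ m, I m = ℓ ↔ (m = p₀ ∨ m = p₁)) ∧
      (T₁.1 p₀).2 = 0 ∧ (T₁.1 p₁).2 ≠ 0 ∧ (T₂.1 p₀).2 ≠ (T₂.1 p₁).2 ∧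
      (T₃.1 p₀).2 ≠ (T₃.1 p₁).2 := by
    intro ℓ hℓ
    rw [hD_def, Finset.mem_filter, Finset.mem_image] at hℓ
    obtain ⟨⟨p₀, hp₀, hIp₀⟩, hcard⟩ := hℓ
    have hp₀0 : (T₁.1 p₀).2 = 0 := by
      simpa [hcol0_def] using hp₀
    have hcard2 : (fib ℓ).card = 2 := le_antisymm (hle2 ℓ) (by omega)
    obtain ⟨a, b, hab, hfab⟩ := Finset.card_eq_two.1 hcard2
    have hmem : ∀ m, I m = ℓ ↔ (m = a ∨ m = b) := by
      intro m
      rw [← mem_fib, hfab, Finset.mem_insert, Finset.mem_singleton]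
    -- name the two preimages so that `p₀` comes first
    obtain ⟨p₁, hp01, hfx⟩ : ∃ p₁, p₀ ≠ p₁ ∧ ∀ m, I m = ℓ ↔ (m = p₀ ∨ m = p₁) := by
      rcases (hmem p₀).1 hIp₀ with rfl | rfl
      · exact ⟨b, hab, hmem⟩
      · exact ⟨a, hab.symm, fun m => (hmem m).trans or_comm⟩
    have hIp₁ : I p₁ = ℓ := (hfx p₁).2 (Or.inr rfl)
    have hsame : I p₀ = I p₁ := hIp₀.trans hIp₁.symm
    refine ⟨p₀, p₁, hp01, hfx, hp₀0, ?_, ?_, ?_⟩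
    · intro h1
      exact inj₁ p₀ p₁ hp01 (hp₀0.trans h1.symm) hsame
    · intro h2
      exact inj₂ p₀ p₁ hp01 h2 hsame
    · intro h3
      exact inj₃ p₀ p₁ hp01 h3 hsame
  exact ⟨x, y, hxy, good x hx, good y hy⟩

/-- **Every elementary pairing of `λₙ` with a power of a rank-`≤ n²+1` tensor vanishes.** For
`n ≥ 2`, standard tableaux `T₁` of shape `(2n²−3,1,1,1)` and `T₂, T₃` of shape `2^{n²}` on the
positions `[2n²]`, and `(n²+1) × (n²+1)` matrices `A, B, C`:
`∑_{I : [2n²] → [n²+1]} ⟨⊗ a_I, e_{T₁}⟩ ⟨⊗ b_I, e_{T₂}⟩ ⟨⊗ c_I, e_{T₃}⟩ = 0`, by the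
letter-exchange involution (§4–§5) on the support described in
`exists_goodDoubles_of_tripleTerm_ne_zero`. [cite: BurgisserIkenmeyer2011, Lemma 6.1] -/
theorem lam_tripleSum_eq_zero
    (hN₁ : ∀ c ∈ (bi2011Last n hn).youngDiagram.cells, c.1 < n ^ 2 + 1)
    (hN₂ : ∀ c ∈ (bi2011TwoRect n).youngDiagram.cells, c.1 < n ^ 2 + 1)
    (T₁ : StdFilling (2 * n ^ 2) (bi2011Last n hn).youngDiagram)
    (T₂ T₃ : StdFilling (2 * n ^ 2) (bi2011TwoRect n).youngDiagram)
    (A B C : Matrix (Fin (n ^ 2 + 1)) (Fin (n ^ 2 + 1)) ℂ) :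
    ∑ I : Fin (2 * n ^ 2) → Fin (n ^ 2 + 1),
      (∑ u : Word (n ^ 2 + 1) (2 * n ^ 2), (∏ m, A (u m) (I m)) * T₁.polytabloid ℂ hN₁ u) *
        (∑ v : Word (n ^ 2 + 1) (2 * n ^ 2), (∏ m, B (v m) (I m)) * T₂.polytabloid ℂ hN₂ v) *
        (∑ w : Word (n ^ 2 + 1) (2 * n ^ 2), (∏ m, C (w m) (I m)) * T₃.polytabloid ℂ hN₂ w) = 0 := by
  refine sum_eq_zero_of_letterSwap _
    (fun I ℓ => ∃ p₀ p₁ : Fin (2 * n ^ 2), p₀ ≠ p₁ ∧ (∀ m, I m = ℓ ↔ (m = p₀ ∨ m = p₁)) ∧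
      (T₁.1 p₀).2 = 0 ∧ (T₁.1 p₁).2 ≠ 0 ∧ (T₂.1 p₀).2 ≠ (T₂.1 p₁).2 ∧
      (T₃.1 p₀).2 ≠ (T₃.1 p₁).2)
    ?_ ?_ ?_ ?_
  · -- the set of good doubles is invariant under the exchange of two of them
    intro I x y hxy hGx hGy ℓ
    have hswap : ∀ (m : Fin (2 * n ^ 2)) (ℓ' : Fin (n ^ 2 + 1)),
        (⇑(Equiv.swap x y) ∘ I) m = ℓ' ↔ I m = Equiv.swap x y ℓ' := by
      intro m ℓ'
      rw [Function.comp_apply, Equiv.apply_eq_iff_eq_symm_apply, Equiv.symm_swap]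
    simp only [hswap]
    -- `G I (swap x y ℓ) ↔ G I ℓ`
    rcases eq_or_ne ℓ x with rfl | hℓx
    · rw [Equiv.swap_apply_left]
      exact ⟨fun _ => hGx, fun _ => hGy⟩
    rcases eq_or_ne ℓ y with rfl | hℓy
    · rw [Equiv.swap_apply_right]
      exact ⟨fun _ => hGy, fun _ => hGx⟩
    rw [Equiv.swap_apply_of_ne_of_ne hℓx hℓy]
  · -- the term changes sign
    intro I x y hxy hGx hGy
    exact tripleTerm_letterSwap hN₁ hN₂ T₁ T₂ T₃ A B C I hxy hGx hGy
  · -- good letters are values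
    rintro I x ⟨p₀, p₁, -, hfx, -⟩
    exact ⟨p₀, (hfx p₀).2 (Or.inl rfl)⟩
  · -- the support carries two good doubles
    intro I hI
    exact exists_goodDoubles_of_tripleTerm_ne_zero hN₁ hN₂ T₁ T₂ T₃ A B C I hI

end Support

/-! ## §7 The unit-tensor half of Lemma 6.1: `λₙ ∉ S(⟨n²+1⟩)` in degree `2n²` -/

section Main

variable {n : ℕ}

/-- Four finite sums commute: the outer index moves inside three others. [folklore] -/
private theorem sum_comm₄ {α β γ δ M : Type*} [Fintype α] [Fintype β] [Fintype γ] [Fintype δ]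
    [AddCommMonoid M] (f : α → β → γ → δ → M) :
    ∑ i, ∑ x, ∑ y, ∑ z, f i x y z = ∑ x, ∑ y, ∑ z, ∑ i, f i x y z := by
  rw [Finset.sum_comm]
  refine Finset.sum_congr rfl fun x _ => ?_
  rw [Finset.sum_comm]
  refine Finset.sum_congr rfl fun y _ => ?_
  exact Finset.sum_comm

/-- **All pairings of `⟨n²+1⟩^{⊗ 2n²}` with highest-weight vectors of weight `λₙ` vanish.** For
`n ≥ 2`, every three `(n²+1) × (n²+1)` matrices `A, B, C` and every three coefficient vectors on
the standard tableaux of shapes `(2n²−3,1,1,1)`, `2^{n²}`, `2^{n²}`: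
`⟪((A⊗B⊗C)·⟨n²+1⟩)^{⊗ 2n²}, ξ₁ ⊗ ξ₂ ⊗ ξ₃⟫ = 0` for `ξ_j = ∑_T a_j(T) e_T` — i.e. (tree
`highestWeightSpace_wordRep_eq_span_polytabloid`) for ALL highest-weight vectors of these weights.
[cite: BurgisserIkenmeyer2011, Lemma 6.1] -/
theorem pairing_unitTensor_lam_eq_zero {hn : 2 ≤ n}
    (hN₁ : ∀ c ∈ (bi2011Last n hn).youngDiagram.cells, c.1 < n ^ 2 + 1)
    (hN₂ : ∀ c ∈ (bi2011TwoRect n).youngDiagram.cells, c.1 < n ^ 2 + 1)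
    (A B C : Matrix (Fin (n ^ 2 + 1)) (Fin (n ^ 2 + 1)) ℂ)
    (a₁ : StdFilling (2 * n ^ 2) (bi2011Last n hn).youngDiagram → ℂ)
    (a₂ a₃ : StdFilling (2 * n ^ 2) (bi2011TwoRect n).youngDiagram → ℂ) :
    ∑ u, ∑ v, ∑ w, kroneckerPow (actTensor A B C (unitTensor ℂ (n ^ 2 + 1))) (2 * n ^ 2) u v w *
      triad (∑ T, a₁ T • T.polytabloid ℂ hN₁) (∑ T, a₂ T • T.polytabloid ℂ hN₂)
        (∑ T, a₃ T • T.polytabloid ℂ hN₂) u v w = 0 := by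
  rw [pairing_unitTensor_eq_sum]
  simp only [sum_prod_mul_sum_smul_polytabloid]
  -- abbreviations for the elementary pairings
  set P₁ : (Fin (2 * n ^ 2) → Fin (n ^ 2 + 1)) →
      StdFilling (2 * n ^ 2) (bi2011Last n hn).youngDiagram → ℂ :=
    fun I T => ∑ u : Word (n ^ 2 + 1) (2 * n ^ 2), (∏ m, A (u m) (I m)) * T.polytabloid ℂ hN₁ u
    with hP₁
  set P₂ : (Fin (2 * n ^ 2) → Fin (n ^ 2 + 1)) →
      StdFilling (2 * n ^ 2) (bi2011TwoRect n).youngDiagram → ℂ :=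
    fun I T => ∑ v : Word (n ^ 2 + 1) (2 * n ^ 2), (∏ m, B (v m) (I m)) * T.polytabloid ℂ hN₂ v
    with hP₂
  set P₃ : (Fin (2 * n ^ 2) → Fin (n ^ 2 + 1)) →
      StdFilling (2 * n ^ 2) (bi2011TwoRect n).youngDiagram → ℂ :=
    fun I T => ∑ w : Word (n ^ 2 + 1) (2 * n ^ 2), (∏ m, C (w m) (I m)) * T.polytabloid ℂ hN₂ w
    with hP₃
  have hexp : ∀ I : Fin (2 * n ^ 2) → Fin (n ^ 2 + 1),
      (∑ T, a₁ T * P₁ I T) * (∑ T, a₂ T * P₂ I T) * (∑ T, a₃ T * P₃ I T) =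
        ∑ T₁, ∑ T₂, ∑ T₃, (a₁ T₁ * a₂ T₂ * a₃ T₃) * (P₁ I T₁ * P₂ I T₂ * P₃ I T₃) := by
    intro I
    rw [Finset.sum_mul_sum, Finset.sum_mul]
    refine Finset.sum_congr rfl fun T₁ _ => ?_
    rw [Finset.sum_mul]
    refine Finset.sum_congr rfl fun T₂ _ => ?_
    rw [Finset.mul_sum]
    refine Finset.sum_congr rfl fun T₃ _ => ?_
    ring
  change ∑ I, (∑ T, a₁ T * P₁ I T) * (∑ T, a₂ T * P₂ I T) * (∑ T, a₃ T * P₃ I T) = 0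
  rw [Finset.sum_congr rfl fun I _ => hexp I, sum_comm₄]
  refine Finset.sum_eq_zero fun T₁ _ => Finset.sum_eq_zero fun T₂ _ =>
    Finset.sum_eq_zero fun T₃ _ => ?_
  rw [← Finset.mul_sum, hP₁, hP₂, hP₃, lam_tripleSum_eq_zero hN₁ hN₂ T₁ T₂ T₃ A B C, mul_zero]

/-- **Bürgisser–Ikenmeyer 2011, Lemma 6.1 — the unit-tensor half, PROVED for every `n ≥ 2`:**
the type `λₙ = ((2n²−3,1,1,1), 2^{n²}, 2^{n²})` does NOT occur in degree `2n²` of the coordinate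
ring of the tensors of border rank `≤ n² + 1`: in the tree's occurrence vocabulary (module
docstring of `UnitTensorSLObstructions.lean`) the triple isotypic character sum of type `λₙ` KILLS
`⟨n²+1⟩^{⊗ 2n²}` — the printed consequence "`λₙ ∉ S(⟨n²+1⟩)`" (closure) of the printed
"`λₙ ∉ S°(⟨n²+1⟩)`" (orbit). Proof: occurrence would give a non-vanishing pairing with a
translate of a triple of highest-weight vectors
(`exists_pairing_ne_zero_of_isotypicSum₁₂₃_kroneckerPow_ne_zero`); these are combinations of
polytabloids (`exists_sum_smul_polytabloid_eq`), and all such pairings vanish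
(`pairing_unitTensor_lam_eq_zero`). This is the second conjunct of the named fact
`burgisserIkenmeyer2011_lemma_6_1`; the road (a sign-reversing involution) is NOT the printed one
(Thm. 4.4 + straightening, which proves the orbit statement).
[cite: BurgisserIkenmeyer2011, Lemma 6.1] -/
theorem isotypicSum_bi2011_kroneckerPow_unitTensor_eq_zero (n : ℕ) (hn : 2 ≤ n) :
    isotypicSum₁ (bi2011Last n hn) (isotypicSum₂ (bi2011TwoRect n) (isotypicSum₃ (bi2011TwoRect n)
      (kroneckerPow (unitTensor ℂ (n ^ 2 + 1)) (2 * n ^ 2)))) = 0 := by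
  by_contra hne
  obtain ⟨A, B, C, ξ₁, ξ₂, ξ₃, h₁, h₂, h₃, hP⟩ :=
    exists_pairing_ne_zero_of_isotypicSum₁₂₃_kroneckerPow_ne_zero
      (lam := ![bi2011Last n hn, bi2011TwoRect n, bi2011TwoRect n]) hne
  have h4 : 4 ≤ n ^ 2 := by nlinarith
  have hc₁ : (bi2011Last n hn).parts.card = 4 := by
    rw [bi2011Last_parts, Multiset.card_add, Multiset.card_singleton, Multiset.card_replicate]
  have hc₂ : (bi2011TwoRect n).parts.card = n ^ 2 := by
    rw [bi2011TwoRect_parts, Multiset.card_replicate]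
  have hN₁ : ∀ c ∈ (bi2011Last n hn).youngDiagram.cells, c.1 < n ^ 2 + 1 := fun c hc =>
    fst_lt_of_mem_youngDiagram (bi2011Last n hn) (by rw [hc₁]; omega) hc
  have hN₂ : ∀ c ∈ (bi2011TwoRect n).youngDiagram.cells, c.1 < n ^ 2 + 1 := fun c hc =>
    fst_lt_of_mem_youngDiagram (bi2011TwoRect n) (by rw [hc₂]; omega) hc
  have hd₁ : (bi2011Last n hn).youngDiagram.cells.card = 2 * n ^ 2 :=
    Nat.Partition.card_cells_youngDiagram _
  have hd₂ : (bi2011TwoRect n).youngDiagram.cells.card = 2 * n ^ 2 :=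
    Nat.Partition.card_cells_youngDiagram _
  have h₁' : ξ₁ ∈ highestWeightSpace (wordRep ℂ (n ^ 2 + 1) (2 * n ^ 2))
      (Weight.ofPartition (n ^ 2 + 1) (bi2011Last n hn)) := h₁
  have h₂' : ξ₂ ∈ highestWeightSpace (wordRep ℂ (n ^ 2 + 1) (2 * n ^ 2))
      (Weight.ofPartition (n ^ 2 + 1) (bi2011TwoRect n)) := h₂
  have h₃' : ξ₃ ∈ highestWeightSpace (wordRep ℂ (n ^ 2 + 1) (2 * n ^ 2))
      (Weight.ofPartition (n ^ 2 + 1) (bi2011TwoRect n)) := h₃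
  rw [← ydWeight_youngDiagram] at h₁' h₂' h₃'
  obtain ⟨a₁, rfl⟩ := exists_sum_smul_polytabloid_eq hN₁ hd₁ h₁'
  obtain ⟨a₂, rfl⟩ := exists_sum_smul_polytabloid_eq hN₂ hd₂ h₂'
  obtain ⟨a₃, rfl⟩ := exists_sum_smul_polytabloid_eq hN₂ hd₂ h₃'
  exact hP (pairing_unitTensor_lam_eq_zero hN₁ hN₂ A B C a₁ a₂ a₃)

/-- **What remains of the named fact `burgisserIkenmeyer2011_lemma_6_1`.** With the unit-tensor
half proved for every `n ≥ 2`, the fact is EQUIVALENT to its matrix-multiplication half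
"`λₙ ∈ S(⟨n,n,n⟩)`" (occurrence of `λₙ` in degree `2n²` for `matMulTensor ℂ n n n`), taken here as
an explicit hypothesis and NOT discharged: its printed proof is "We explicitly constructed `f` and
(guided by computer calculations) proved that `f(⟨n,n,n⟩) ≠ 0`", details omitted in print
(§10.18). [cite: BurgisserIkenmeyer2011, Lemma 6.1] -/
theorem burgisserIkenmeyer2011_lemma_6_1_of_occurrence
    (hocc : ∀ (n : ℕ) (hn : 2 ≤ n),
      isotypicSum₁ (bi2011Last n hn) (isotypicSum₂ (bi2011TwoRect n) (isotypicSum₃ (bi2011TwoRect n)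
        (kroneckerPow (matMulTensor ℂ n n n) (2 * n ^ 2)))) ≠ 0) :
    burgisserIkenmeyer2011_lemma_6_1 := fun n hn =>
  ⟨hocc n hn, isotypicSum_bi2011_kroneckerPow_unitTensor_eq_zero n hn⟩

/-- Conversely the named fact contains the matrix-multiplication half (so the reduction above
loses nothing). [cite: BurgisserIkenmeyer2011, Lemma 6.1] -/
theorem occurrence_of_burgisserIkenmeyer2011_lemma_6_1 (h : burgisserIkenmeyer2011_lemma_6_1)
    (n : ℕ) (hn : 2 ≤ n) :
    isotypicSum₁ (bi2011Last n hn) (isotypicSum₂ (bi2011TwoRect n) (isotypicSum₃ (bi2011TwoRect n)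
      (kroneckerPow (matMulTensor ℂ n n n) (2 * n ^ 2)))) ≠ 0 :=
  (h n hn).1

end Main

end Literature.Computability.AlgebraicComplexity
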